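import Mathlib.NumberTheory.FLT.Four
import Mathlib.Data.Nat.Factorization.Basic
import HarnessLib

/-!
# Fermat's theorem on `x⁴ − y⁴ = z²` (the area of a Pythagorean triangle is not a square)

Topic `NumberTheory/EllipticCurves`; namespace `Literature.NumberTheory.EllipticCurves`.

Mathlib proves Fermat's theorem that `a⁴ + b⁴ = c²` has no solution in nonzero integers
(`not_fermat_42`, Hardy–Wright Thm 226). This file proves the companion theorem, also Fermat's
(it is his proof that the area of a right triangle with integer sides is never a square, i.e. that
`1` is not a congruent number):

* `fermat_fourth_pow_sub_fourth_pow_ne_sq` — for integers `a b c` with `b ≠ 0` and `c ≠ 0`,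
  `a⁴ − b⁴ ≠ c²` [Koshy, *Elementary Number Theory with Applications* (2001), Thm 13.3;
  Knapp, *Elliptic Curves*, proof of Cor. 4.22 computes the same fact as "`y² = x³ − x` has rank
  `0`"].

The proof is Fermat's infinite descent exactly as printed in Koshy (solution of the exercise to
Thm 13.3): for a solution with `gcd(a, b) = 1` and `|a|` minimal, `(b², c, a²)` is a primitive
Pythagorean triple. If `c` is even, `b² = m² − n²`, `c = 2mn`, `a² = m² + n²` and then
`m⁴ − n⁴ = (ab)²` is a smaller solution. If `c` is odd, `b² = 2mn`, `a² = m² + n²` with `m, n > 0`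
coprime of opposite parity; writing `p` for the odd one and `q` for the even one, `p = s²`,
`q = 2t²`, so `(s²)² + (2t²)² = a²` is again a primitive Pythagorean triple, `s² = u² − v²`,
`t² = uv`, whence `u = α²`, `v = β²` and `α⁴ − β⁴ = s²` is a smaller solution. We organise the
descent as a strong induction on `|a|` (a non-primitive solution is first divided by a common prime
of `a` and `b`), using Mathlib's `PythagoreanTriple.coprime_classification'` and
`Int.sq_of_gcd_eq_one`, in the style of Mathlib's proof of `not_fermat_42`.

The elliptic-curve consequences (the rational points of `y² = x³ − x` and `y² = x³ + x`, Fermat's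
"`1` is not a congruent number", used by Mestre–Oesterlé 1989 in part 9 of the proof of their
Théorème 1) are in `Literature.NumberTheory.EllipticCurves.CongruentNumberOne`.

## References

* [Koshy2001] T. Koshy, *Elementary Number Theory with Applications*, Harcourt/Academic Press
  2001 — Thm 13.3 (Fermat: `x⁴ − y⁴ = z²` has no positive integral solutions), Cor. 13.4 (the area
  of a Pythagorean triangle is not a square), and the printed descent (solution to Exercise 17 of
  §13.2).
* [HardyWright2008] G. H. Hardy, E. M. Wright, *An Introduction to the Theory of Numbers*, 6th ed.,
  OUP 2008 — Thm 226 (`x⁴ + y⁴ = z²`, Mathlib's `not_fermat_42`).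
* [Knapp1993] A. W. Knapp, *Elliptic Curves*, Princeton 1992 — Cor. 4.22 (Fermat: `1` is not a
  congruent number).
-/

namespace Literature.NumberTheory.EllipticCurves

/-- An odd integer is coprime to `2` (Bézout: `1 · p − (p / 2) · 2 = p % 2 = 1`). [folklore] -/
private theorem isCoprime_two_of_emod_two_eq_one {p : ℤ} (hp : p % 2 = 1) : IsCoprime p 2 := by
  refine ⟨1, -(p / 2), ?_⟩
  have := Int.emod_add_mul_ediv p 2
  linarith

/-- In `ℤ`, if `a * b` is a square, `gcd a b = 1` and `0 ≤ a`, then `a` is a square (the sign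
ambiguity of `Int.sq_of_gcd_eq_one` disappears for nonnegative `a`). [folklore] -/
private theorem exists_eq_sq_of_gcd_eq_one {a b c : ℤ} (h : Int.gcd a b = 1) (heq : a * b = c ^ 2)
    (ha : 0 ≤ a) : ∃ d : ℤ, a = d ^ 2 := by
  obtain ⟨d, hd | hd⟩ := Int.sq_of_gcd_eq_one h heq
  · exact ⟨d, hd⟩
  · refine ⟨0, ?_⟩
    nlinarith [sq_nonneg d]

/-- **Descent step, odd leg.** If `a² = p² + q²` and `b² = 2pq` with `a, p, q > 0`, `gcd(p, q) = 1`
and `p` odd, then there is a solution `α⁴ = β⁴ + s²` (`β, s ≠ 0`) with `|α| < a`: indeed `p = s²`,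
`q = 2t²`, `(s²)² + (2t²)² = a²` is a primitive Pythagorean triple, so `s² = u² − v²`, `t² = uv`,
`a = u² + v²`, and `u = α²`, `v = β²` (Koshy, solution of Thm 13.3, case 2). [cite: Koshy2001, Thm 13.3] -/
private theorem fermat_descent_odd_leg {a b p q : ℤ} (ha : 0 < a) (hp : 0 < p) (hq : 0 < q)
    (hpq : Int.gcd p q = 1) (hp2 : p % 2 = 1) (h1 : b ^ 2 = 2 * p * q)
    (h2 : a ^ 2 = p ^ 2 + q ^ 2) :
    ∃ a' b' c' : ℤ, b' ≠ 0 ∧ c' ≠ 0 ∧ a' ^ 4 = b' ^ 4 + c' ^ 2 ∧ a'.natAbs < a.natAbs := by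
  -- `p` and `2q` are coprime with product the square `b²`, so `p = s²` and `2q = r²`
  have hp2q : Int.gcd p (2 * q) = 1 :=
    Int.isCoprime_iff_gcd_eq_one.mp
      ((isCoprime_two_of_emod_two_eq_one hp2).mul_right (Int.isCoprime_iff_gcd_eq_one.mpr hpq))
  have hprod : p * (2 * q) = b ^ 2 := by rw [h1]; ring
  obtain ⟨s, hs⟩ := exists_eq_sq_of_gcd_eq_one hp2q hprod hp.le
  have hprod' : 2 * q * p = b ^ 2 := by rw [h1]; ring
  rw [Int.gcd_comm] at hp2q
  obtain ⟨r, hr⟩ := exists_eq_sq_of_gcd_eq_one hp2q hprod' (by positivity)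
  -- `r` is even, `r = 2t`, so `q = 2t²`
  have h2r : (2 : ℤ) ∣ r := by
    apply Int.prime_two.dvd_of_dvd_pow (n := 2)
    rw [← hr]
    exact dvd_mul_right 2 q
  obtain ⟨t, rfl⟩ := h2r
  have hqt : q = 2 * t ^ 2 := by
    have : 2 * q = 2 * (2 * t ^ 2) := by rw [hr]; ring
    linarith
  have ht0 : t ≠ 0 := by
    rintro rfl
    simp only [ne_eq, OfNat.ofNat_ne_zero, not_false_eq_true, zero_pow, mul_zero] at hqt
    exact hq.ne' hqt
  have hs0 : s ≠ 0 := by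
    rintro rfl
    simp only [ne_eq, OfNat.ofNat_ne_zero, not_false_eq_true, zero_pow] at hs
    exact hp.ne' hs
  -- `s` is odd since `p = s²` is
  have hs2 : s ^ 2 % 2 = 1 := by rw [← hs]; exact hp2
  -- second primitive Pythagorean triple `(s²)² + (2t²)² = a²`
  have ht : PythagoreanTriple (s ^ 2) (2 * t ^ 2) a := by
    delta PythagoreanTriple
    rw [hs, hqt] at h2
    linear_combination (-1 : ℤ) * h2
  have hcop2 : Int.gcd (s ^ 2) (2 * t ^ 2) = 1 := by rw [← hs, ← hqt]; exact hpq
  obtain ⟨u, v, hu1, hu2, hu3, hu4, -, hu6⟩ := ht.coprime_classification' hcop2 hs2 ha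
  -- `hu1 : s² = u² − v²`, `hu2 : 2t² = 2uv`, `hu3 : a = u² + v²`, `hu4 : gcd u v = 1`, `0 ≤ u`
  have huv : u * v = t ^ 2 := by linarith
  have ht2 : 0 < t ^ 2 := by positivity
  have hu0 : u ≠ 0 := by
    rintro rfl
    rw [zero_mul] at huv
    exact ht2.ne huv
  have hupos : 0 < u := lt_of_le_of_ne hu6 (Ne.symm hu0)
  have hvpos : 0 < v := by
    rcases lt_or_ge 0 v with hv | hv
    · exact hv
    · linarith [mul_nonpos_iff.mpr (Or.inl ⟨hu6, hv⟩)]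
  obtain ⟨α, hα⟩ := exists_eq_sq_of_gcd_eq_one hu4 huv hu6
  rw [Int.gcd_comm] at hu4
  obtain ⟨β, hβ⟩ := exists_eq_sq_of_gcd_eq_one hu4 (by rw [mul_comm]; exact huv) hvpos.le
  refine ⟨α, β, s, ?_, hs0, ?_, ?_⟩
  · rintro rfl
    simp only [ne_eq, OfNat.ofNat_ne_zero, not_false_eq_true, zero_pow] at hβ
    exact hvpos.ne' hβ
  · rw [hα, hβ] at hu1
    linear_combination (-1 : ℤ) * hu1
  · -- `|α| ≤ α² ≤ α⁴ = u² < u² + v² = a`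
    have h1' : (α.natAbs : ℤ) ≤ u ^ 2 :=
      calc (α.natAbs : ℤ) ≤ α ^ 2 := Int.natAbs_le_self_sq α
        _ ≤ (α ^ 2) ^ 2 := Int.le_self_sq _
        _ = u ^ 2 := by rw [hα]
    have h2' : u ^ 2 < a := by
      rw [hu3]
      have : 0 < v ^ 2 := by positivity
      linarith
    have h3' : (α.natAbs : ℤ) < (a.natAbs : ℤ) := by
      rw [Int.natCast_natAbs a, abs_of_pos ha]
      exact h1'.trans_lt h2'
    exact_mod_cast h3'

/-- **Descent step.** A solution of `a⁴ = b⁴ + c²` with `b, c ≠ 0` and `gcd(a, b) = 1` yields one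
with strictly smaller `|a|` (Koshy, solution of Thm 13.3: `(b², c, a²)` is a primitive Pythagorean
triple; case 1, `c` even: `m⁴ − n⁴ = (ab)²`; case 2, `c` odd: `fermat_descent_odd_leg`).
[cite: Koshy2001, Thm 13.3] -/
private theorem fermat_descent {a b c : ℤ} (hab : IsCoprime a b) (hb : b ≠ 0) (hc : c ≠ 0)
    (h : a ^ 4 = b ^ 4 + c ^ 2) :
    ∃ a' b' c' : ℤ, b' ≠ 0 ∧ c' ≠ 0 ∧ a' ^ 4 = b' ^ 4 + c' ^ 2 ∧ a'.natAbs < a.natAbs := by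
  have ha : a ≠ 0 := by
    rintro rfl
    have : (0 : ℤ) < b ^ 4 + c ^ 2 := by positivity
    rw [← h] at this
    norm_num at this
  -- `b²` and `c` are coprime: `c² = a⁴ − b⁴` and `gcd(a, b) = 1`
  have hbc : Int.gcd (b ^ 2) c = 1 := by
    apply Int.isCoprime_iff_gcd_eq_one.mp
    have h4 : IsCoprime (b ^ 4) (c ^ 2) := by
      have e : c ^ 2 = a ^ 4 + b ^ 4 * (-1) := by linear_combination (-1 : ℤ) * h
      rw [e]
      exact (IsCoprime.pow (m := 4) (n := 4) hab.symm).add_mul_left_right (-1)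
    have e4 : b ^ 4 = (b ^ 2) ^ 2 := by ring
    rw [e4] at h4
    exact (IsCoprime.pow_iff two_pos two_pos).mp h4
  have ha2 : 0 < a ^ 2 := by positivity
  rcases Int.emod_two_eq_zero_or_one c with hc2 | hc2
  · -- Case 1: `c` even, hence `b` odd (else `2 ∣ a`, contradicting `gcd(a, b) = 1`)
    have hb2 : b ^ 2 % 2 = 1 := by
      rcases Int.emod_two_eq_zero_or_one b with hb2 | hb2
      · exfalso
        have h2b : (2 : ℤ) ∣ b := Int.dvd_of_emod_eq_zero hb2
        have h2c : (2 : ℤ) ∣ c := Int.dvd_of_emod_eq_zero hc2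
        have h2a : (2 : ℤ) ∣ a := by
          apply Int.prime_two.dvd_of_dvd_pow (n := 4)
          rw [h]
          exact dvd_add (dvd_pow h2b (by norm_num)) (dvd_pow h2c (by norm_num))
        obtain ⟨u, v, huv⟩ := hab
        have h21 : (2 : ℤ) ∣ 1 := by
          rw [← huv]
          exact dvd_add (dvd_mul_of_dvd_right h2a u) (dvd_mul_of_dvd_right h2b v)
        norm_num at h21
      · rw [sq, Int.mul_emod, hb2]
        decide
    have ht : PythagoreanTriple (b ^ 2) c (a ^ 2) := by
      delta PythagoreanTriple
      linear_combination (-1 : ℤ) * h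
    obtain ⟨m, n, hm1, hm2, hm3, -, -, -⟩ := ht.coprime_classification' hbc hb2 ha2
    -- `hm1 : b² = m² − n²`, `hm2 : c = 2mn`, `hm3 : a² = m² + n²`
    have hn0 : n ≠ 0 := by
      rintro rfl
      apply hc
      rw [hm2]
      ring
    refine ⟨m, n, a * b, hn0, mul_ne_zero ha hb, ?_, ?_⟩
    · linear_combination (-(m ^ 2 + n ^ 2)) * hm1 + (-(b ^ 2)) * hm3
    · have hn2 : 0 < n ^ 2 := by positivity
      have habs : |m| < |a| := sq_lt_sq.mp (by rw [hm3]; linarith)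
      rw [Int.abs_eq_natAbs, Int.abs_eq_natAbs, Nat.cast_lt] at habs
      exact habs
  · -- Case 2: `c` odd: `b² = 2mn`, `a² = m² + n²`
    have ht : PythagoreanTriple c (b ^ 2) (a ^ 2) := by
      delta PythagoreanTriple
      linear_combination (-1 : ℤ) * h
    rw [Int.gcd_comm] at hbc
    obtain ⟨m, n, -, hm2, hm3, hm4, hm5, hm6⟩ := ht.coprime_classification' hbc hc2 ha2
    have hb2pos : 0 < b ^ 2 := by positivity
    have hmpos : 0 < m := by
      rcases hm6.lt_or_eq with h' | h'
      · exact h'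
      · exfalso
        rw [← h', mul_zero, zero_mul] at hm2
        exact hb2pos.ne' hm2
    have hnpos : 0 < n := by nlinarith
    -- replace `a` by `|a|`, which is positive and has the same square
    have ha' : 0 < |a| := abs_pos.mpr ha
    have hm3' : |a| ^ 2 = m ^ 2 + n ^ 2 := by rw [sq_abs]; exact hm3
    rw [← Int.natAbs_abs a]
    rcases hm5 with ⟨-, hn1⟩ | ⟨hm1, -⟩
    · -- `m` even, `n` odd: the odd leg is `n`
      exact fermat_descent_odd_leg ha' hnpos hmpos (by rwa [Int.gcd_comm]) hn1
        (by rw [hm2]; ring) (by rw [hm3']; ring)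
    · exact fermat_descent_odd_leg ha' hmpos hnpos hm4 hm1 hm2 hm3'

/-- **Fermat's theorem on `x⁴ − y⁴ = z²`** (Koshy, Thm 13.3: "The diophantine equation
`x⁴ − y⁴ = z²` has no positive integral solutions"; equivalently, Cor. 13.4, the area of a
Pythagorean triangle is never a square, and Knapp Cor. 4.22, `1` is not a congruent number). Over
`ℤ`: if `b ≠ 0` and `c ≠ 0` then `a⁴ − b⁴ ≠ c²` (the excluded cases are the trivial solutions
`a⁴ − 0⁴ = (a²)²` and `a⁴ − (±a)⁴ = 0²`). Proof by Fermat's infinite descent (`fermat_descent`),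
run as a strong induction on `|a|`; compare Mathlib's `not_fermat_42` for `a⁴ + b⁴ ≠ c²`.
[cite: Koshy2001, Thm 13.3] -/
theorem fermat_fourth_pow_sub_fourth_pow_ne_sq {a b c : ℤ} (hb : b ≠ 0) (hc : c ≠ 0) :
    a ^ 4 - b ^ 4 ≠ c ^ 2 := by
  suffices H : ∀ (k : ℕ) (a b c : ℤ), a.natAbs = k → b ≠ 0 → c ≠ 0 → a ^ 4 ≠ b ^ 4 + c ^ 2 by
    intro h
    exact H _ a b c rfl hb hc (by linear_combination h)
  intro k
  induction k using Nat.strong_induction_on with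
  | _ k ih =>
  intro a b c hk hb hc h
  subst hk
  by_cases hab : IsCoprime a b
  · obtain ⟨a', b', c', hb', hc', h', hlt⟩ := fermat_descent hab hb hc h
    exact ih _ hlt a' b' c' rfl hb' hc' h'
  · -- divide out a common prime `p` of `a` and `b`; then `p² ∣ c`
    rw [Int.isCoprime_iff_gcd_eq_one] at hab
    obtain ⟨p, hp, hpa, hpb⟩ := Nat.Prime.not_coprime_iff_dvd.mp hab
    obtain ⟨a1, rfl⟩ := Int.natCast_dvd.mpr hpa
    obtain ⟨b1, rfl⟩ := Int.natCast_dvd.mpr hpb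
    have hp0 : (p : ℤ) ≠ 0 := Int.natCast_ne_zero.mpr hp.ne_zero
    have hpc : (p : ℤ) ^ 2 ∣ c := by
      rw [← Int.pow_dvd_pow_iff two_ne_zero]
      exact ⟨a1 ^ 4 - b1 ^ 4, by linear_combination (-1 : ℤ) * h⟩
    obtain ⟨c1, rfl⟩ := hpc
    have h1 : a1 ^ 4 = b1 ^ 4 + c1 ^ 2 := by
      apply mul_left_cancel₀ (pow_ne_zero 4 hp0)
      linear_combination h
    have hb1 : b1 ≠ 0 := by
      rintro rfl
      exact hb (mul_zero _)
    have hc1 : c1 ≠ 0 := by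
      rintro rfl
      exact hc (mul_zero _)
    have ha1 : a1 ≠ 0 := by
      rintro rfl
      have : (0 : ℤ) < b1 ^ 4 + c1 ^ 2 := by positivity
      rw [← h1] at this
      norm_num at this
    refine ih _ ?_ a1 b1 c1 rfl hb1 hc1 h1
    rw [Int.natAbs_mul, Int.natAbs_natCast]
    exact lt_mul_of_one_lt_left (Int.natAbs_pos.mpr ha1) hp.one_lt

/-- `2x² = z²` has no integer solution with `x ≠ 0` (`√2` is irrational): compare the exponent of
`2` in the factorisations of both sides. [folklore] -/
private theorem two_mul_sq_ne_sq {x z : ℤ} (hx : x ≠ 0) : 2 * x ^ 2 ≠ z ^ 2 := by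
  intro h
  have hX : x.natAbs ≠ 0 := Int.natAbs_ne_zero.mpr hx
  have hN : 2 * x.natAbs ^ 2 = z.natAbs ^ 2 := by
    have := congrArg Int.natAbs h
    simpa [Int.natAbs_mul, Int.natAbs_pow] using this
  have hZ : z.natAbs ≠ 0 := by
    intro hz
    rw [hz] at hN
    have : x.natAbs ^ 2 = 0 := by omega
    exact hX (pow_eq_zero_iff two_ne_zero |>.mp this)
  have key := congrArg (fun n => n.factorization 2) hN
  simp only [Nat.factorization_mul two_ne_zero (pow_ne_zero 2 hX), Nat.factorization_pow,
    Finsupp.add_apply, Finsupp.smul_apply, smul_eq_mul, Nat.prime_two.factorization_self] at key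
  omega

/-- **Fermat: the area of a Pythagorean triangle is not a square** (Koshy, Cor. 13.4; Fermat's
marginal note in Diophantus). If `x² + y² = z²` with `x, y ≠ 0` integers, then `xy/2` is not the
square of an integer: from `xy = 2s²` one gets `(x² − y²)² = z⁴ − (2s)⁴`, contradicting
`fermat_fourth_pow_sub_fourth_pow_ne_sq` unless `x² = y²`, which is impossible for a Pythagorean
triple with nonzero legs (`2x² = z²`). [cite: Koshy2001, Cor. 13.4] -/
theorem pythagoreanTriple_area_ne_sq {x y z s : ℤ} (h : PythagoreanTriple x y z) (hx : x ≠ 0)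
    (hy : y ≠ 0) : x * y ≠ 2 * s ^ 2 := by
  intro hs
  have hpy : x * x + y * y = z * z := h
  have hs0 : s ≠ 0 := by
    rintro rfl
    have h0 : x * y = 0 := by simpa using hs
    rcases mul_eq_zero.mp h0 with h0 | h0
    · exact hx h0
    · exact hy h0
  -- `(x² − y²)² = z⁴ − (2s)⁴`
  have key : z ^ 4 - (2 * s) ^ 4 = (x ^ 2 - y ^ 2) ^ 2 := by
    linear_combination (-(x * x + y * y + z * z)) * hpy + (4 * x * y + 8 * s ^ 2) * hs
  by_cases hxy : x ^ 2 - y ^ 2 = 0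
  · -- then `2x² = z²`, impossible for `x ≠ 0`
    exact two_mul_sq_ne_sq (z := z) hx (by linear_combination hpy + hxy)
  · exact fermat_fourth_pow_sub_fourth_pow_ne_sq (mul_ne_zero two_ne_zero hs0) hxy key

end Literature.NumberTheory.EllipticCurves
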